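import Summits.NavierStokesRegularity.NavierStokesRegularity.Theorems.SoloSalvageWu2026ConstructTools
import Literature.Analysis.FluidPDE.LerayHopfH1Test
import Mathlib.MeasureTheory.Measure.Haar.NormedSpace
import Mathlib.MeasureTheory.Function.ConvergenceInMeasure
import HarnessLib

/-!
# C177 `Wu2026` — tools for sub-binder (A) of `Step_construct` (velocity compactness (3.26)–(3.28)):
# the annular bound (3.18) at every scale, a countable cover of `ℝ³ ∖ {0}` by admissible balls,
# and the `L¹ → L⁴` upgrade of local convergence (cell `pub/ns-inputs`, seat `ns-in-wu-con`;
# route business of `GaldiLiouvilleGate`, item stmt-NavierStokesRegularity-0897)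

Tools for the reduction of piece (A) of `step_construct_of_pieces` (`SoloSalvageWu2026Construct.lean`)
to a uniform local gradient bound (Rellich–Kondrachov route, p.11 l.13–50):

* `integral_annulus_blowDown_rpow_le` — (3.18) is scale invariant: `∫_{A_S} |V_R|^q ≤ (C_q S^{-2/3+3/q})^q`
  for every blow-down `V_R = R^{2/3}v(R·)`, `R > 0` (change of variables `x = Ry`);
* `exists_centres_cover_punctured` — a sequence of centres `c_k ≠ 0` whose balls
  `B(c_k, |c_k|/3) ⊆ A_{2|c_k|/3}` cover `ℝ³ ∖ {0}` (separability);
* `lintegral_rpow_le_of_tendsto_lintegral` — uniform `L^q` bounds pass to `L¹` limits (Fatou along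
  an a.e. subsequence);
* `tendsto_lintegral_rpow_four_of_one` — `L¹(B)` convergence plus uniform `L^q(B)` bounds, `q > 4`,
  give `L⁴(B)` convergence (interpolation `∫f⁴ ≤ (∫f)^{(q-4)/(q-1)} (∫f^q)^{3/(q-1)}`,
  `Literature.Analysis.FluidPDE.lintegral_rpow_interpolate`).

Theorems only, standard axioms, no `sorry`.

WHAT THIS IS NOT: not a proof of `Step_construct`; not a claim about NS regularity or blow-up; not
a claim about any author beyond the typed locator.
-/

set_option linter.dupNamespace false

noncomputable section

open MeasureTheory Set Filter Topology Module Metric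
open scoped ENNReal NNReal Topology RealInnerProductSpace Pointwise

namespace Summit.NavierStokesRegularity.NavierStokesRegularity.Theorems.Wu2026Salvage

open Literature.Analysis.FluidPDE Literature.Analysis.FunctionSpaces Literature.Claims.NS.Wu2026

/-! ## (3.18) at every scale -/

/-- `R • A_S = A_{RS}` for `R > 0`. [folklore] -/
theorem smul_annulus {R : ℝ} (hR : 0 < R) (S : ℝ) : R • annulus S = annulus (R * S) := by
  ext x
  rw [Set.mem_smul_set_iff_inv_smul_mem₀ hR.ne']
  show (S < ‖R⁻¹ • x‖ ∧ ‖R⁻¹ • x‖ < 2 * S) ↔ (R * S < ‖x‖ ∧ ‖x‖ < 2 * (R * S))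
  rw [norm_smul, norm_inv, Real.norm_of_nonneg hR.le, inv_mul_eq_div, lt_div_iff₀ hR,
    div_lt_iff₀ hR]
  constructor
  · rintro ⟨h1, h2⟩; exact ⟨by linarith, by linarith⟩
  · rintro ⟨h1, h2⟩; exact ⟨by linarith, by linarith⟩

/-- Change of variables for the blow-down on annuli:
`∫_{A_S} |V_R|^q dy = R^{2q/3} R^{-3} ∫_{A_{RS}} |v|^q dx`. [cite: Wu2026, (3.19)–(3.20) p.10] -/
theorem integral_annulus_blowDown_rpow {R : ℝ} (hR : 0 < R) (v : E3 → E3) (q S : ℝ) :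
    ∫ y in annulus S, ‖blowDown R v y‖ ^ q =
      R ^ ((2 : ℝ) / 3 * q) * (R ^ 3)⁻¹ * ∫ x in annulus (R * S), ‖v x‖ ^ q := by
  have hfun : (fun y : E3 => ‖blowDown R v y‖ ^ q) =
      fun y => R ^ ((2 : ℝ) / 3 * q) * (fun x => ‖v x‖ ^ q) (R • y) := by
    funext y
    unfold blowDown
    rw [norm_smul, Real.norm_of_nonneg (Real.rpow_nonneg hR.le _), Real.mul_rpow
      (Real.rpow_nonneg hR.le _) (norm_nonneg _), ← Real.rpow_mul hR.le]
  rw [hfun, integral_const_mul, Measure.setIntegral_comp_smul_of_pos (volume : Measure E3)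
    (fun x => ‖v x‖ ^ q) (annulus S) hR, smul_annulus hR, finrank_euclideanSpace,
    Fintype.card_fin, smul_eq_mul, mul_assoc]

/-- **(3.18) is scale invariant** (p.10 l.55 – p.11 l.12): if
`‖v‖_{L^q(A_R)} ≤ C R^{-2/3+3/q}` for all `R > 0` then every blow-down satisfies
`∫_{A_S} |V_R|^q ≤ (C S^{-2/3+3/q})^q`, uniformly in `R > 0`. [cite: Wu2026, (3.18)–(3.20) p.10–11] -/
theorem integral_annulus_blowDown_rpow_le {v : E3 → E3} {q C : ℝ} (hq : 0 < q)
    (h : ∀ R : ℝ, 0 < R → IntegrableOn (fun x => ‖v x‖ ^ q) (annulus R) ∧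
      (∫ x in annulus R, ‖v x‖ ^ q) ^ (1 / q) ≤ C * R ^ (-(2 : ℝ) / 3 + 3 / q))
    {R S : ℝ} (hR : 0 < R) (hS : 0 < S) :
    ∫ y in annulus S, ‖blowDown R v y‖ ^ q ≤ (C * S ^ (-(2 : ℝ) / 3 + 3 / q)) ^ q := by
  have hRS : 0 < R * S := mul_pos hR hS
  obtain ⟨_, hb⟩ := h (R * S) hRS
  have hI0 : 0 ≤ ∫ x in annulus (R * S), ‖v x‖ ^ q :=
    integral_nonneg fun x => Real.rpow_nonneg (norm_nonneg _) _
  have hC0 : 0 ≤ C * (R * S) ^ (-(2 : ℝ) / 3 + 3 / q) :=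
    (Real.rpow_nonneg hI0 _).trans hb
  -- `∫_{A_{RS}} |v|^q ≤ (C (RS)^e)^q`
  have hIq : ∫ x in annulus (R * S), ‖v x‖ ^ q ≤ (C * (R * S) ^ (-(2 : ℝ) / 3 + 3 / q)) ^ q := by
    have := Real.rpow_le_rpow (Real.rpow_nonneg hI0 _) hb hq.le
    rwa [← Real.rpow_mul hI0, one_div_mul_cancel hq.ne', Real.rpow_one] at this
  rw [integral_annulus_blowDown_rpow hR v q S]
  have hCS0 : 0 ≤ C := by
    have hpos : 0 < (R * S) ^ (-(2 : ℝ) / 3 + 3 / q) := Real.rpow_pos_of_pos hRS _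
    nlinarith [hC0, hpos, mul_nonneg_iff_of_pos_right hpos |>.1 hC0]
  calc R ^ ((2 : ℝ) / 3 * q) * (R ^ 3)⁻¹ * ∫ x in annulus (R * S), ‖v x‖ ^ q
      ≤ R ^ ((2 : ℝ) / 3 * q) * (R ^ 3)⁻¹ * (C * (R * S) ^ (-(2 : ℝ) / 3 + 3 / q)) ^ q := by
        gcongr
    _ = (C * S ^ (-(2 : ℝ) / 3 + 3 / q)) ^ q := by
        rw [Real.mul_rpow hCS0 (Real.rpow_nonneg hRS.le _),
          Real.mul_rpow hCS0 (Real.rpow_nonneg hS.le _), Real.mul_rpow hR.le hS.le,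
          Real.mul_rpow (Real.rpow_nonneg hR.le _) (Real.rpow_nonneg hS.le _),
          ← Real.rpow_mul hR.le, ← Real.rpow_mul hS.le]
        have h3 : (R ^ (3 : ℕ))⁻¹ = R ^ (-(3 : ℝ)) := by
          rw [Real.rpow_neg hR.le]
          congr 1
          exact_mod_cast (Real.rpow_natCast R 3).symm
        rw [h3]
        have hexp : R ^ ((2 : ℝ) / 3 * q) * R ^ (-(3 : ℝ)) * R ^ ((-(2 : ℝ) / 3 + 3 / q) * q) = 1 := by
          rw [← Real.rpow_add hR, ← Real.rpow_add hR]
          have : (2 : ℝ) / 3 * q + -3 + (-(2 : ℝ) / 3 + 3 / q) * q = 0 := by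
            field_simp; ring
          rw [this, Real.rpow_zero]
        calc R ^ ((2 : ℝ) / 3 * q) * R ^ (-(3 : ℝ)) *
              (C ^ q * (R ^ ((-(2 : ℝ) / 3 + 3 / q) * q) * S ^ ((-(2 : ℝ) / 3 + 3 / q) * q)))
            = (R ^ ((2 : ℝ) / 3 * q) * R ^ (-(3 : ℝ)) * R ^ ((-(2 : ℝ) / 3 + 3 / q) * q)) *
                (C ^ q * S ^ ((-(2 : ℝ) / 3 + 3 / q) * q)) := by ring
          _ = C ^ q * S ^ ((-(2 : ℝ) / 3 + 3 / q) * q) := by rw [hexp, one_mul]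

/-! ## Admissible balls -/

/-- For `c ≠ 0`, the ball `B(c, |c|/3)` lies in the dyadic annulus `A_{2|c|/3}`. [folklore] -/
theorem ball_subset_annulus {c : E3} (hc : c ≠ 0) : ball c (‖c‖ / 3) ⊆ annulus (2 * ‖c‖ / 3) := by
  intro y hy
  rw [mem_ball, dist_eq_norm] at hy
  have h1 : ‖y‖ ≤ ‖c‖ + ‖y - c‖ := by
    calc ‖y‖ = ‖c + (y - c)‖ := by rw [add_sub_cancel]
      _ ≤ ‖c‖ + ‖y - c‖ := norm_add_le _ _
  have h2 : ‖c‖ ≤ ‖y‖ + ‖y - c‖ := by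
    calc ‖c‖ = ‖y - (y - c)‖ := by rw [sub_sub_cancel]
      _ ≤ ‖y‖ + ‖y - c‖ := norm_sub_le _ _
  have hc0 : 0 < ‖c‖ := norm_pos_iff.2 hc
  refine ⟨by linarith, by linarith⟩

/-- For `c ≠ 0`, the ball `B(c, |c|/3)` lies in `ℝ³ ∖ {0}`. [folklore] -/
theorem ball_subset_punctured {c : E3} (hc : c ≠ 0) : ball c (‖c‖ / 3) ⊆ punctured := by
  intro y hy h0
  have hc0 : 0 < ‖c‖ := norm_pos_iff.2 hc
  have := (ball_subset_annulus hc hy).1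
  rw [show (y : E3) = 0 from h0, norm_zero] at this
  linarith

/-- **A countable family of admissible balls covering `ℝ³ ∖ {0}`**: there are centres `c_k ≠ 0`
such that every `y ≠ 0` lies in some `B(c_k, |c_k|/3)` (density of a sequence in `ℝ³`; the
«nested exhaustion» of p.11 l.44–47 by countably many pieces). [cite: Wu2026, (3.28) p.11 l.44–50] -/
theorem exists_centres_cover_punctured :
    ∃ c : ℕ → E3, (∀ k, c k ≠ 0) ∧ ∀ y : E3, y ≠ 0 → ∃ k, y ∈ ball (c k) (‖c k‖ / 3) := by
  obtain ⟨u, hu⟩ := TopologicalSpace.exists_dense_seq E3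
  set e : E3 := EuclideanSpace.single 0 1 with he
  have he0 : e ≠ 0 := by
    intro h
    have := congrArg (fun z : E3 => z 0) h
    simp [he] at this
  refine ⟨fun k => if u k = 0 then e else u k, fun k => ?_, fun y hy => ?_⟩
  · by_cases h : u k = 0 <;> simp [h, he0]
  · have hy0 : 0 < ‖y‖ := norm_pos_iff.2 hy
    obtain ⟨k, hk⟩ := Metric.denseRange_iff.1 hu y (‖y‖ / 4) (by positivity)
    rw [dist_eq_norm] at hk
    have huk : u k ≠ 0 := by
      intro h
      rw [h, sub_zero] at hk
      linarith
    refine ⟨k, ?_⟩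
    simp only [huk, if_false]
    rw [mem_ball, dist_eq_norm]
    have h2 : ‖y‖ ≤ ‖u k‖ + ‖y - u k‖ := by
      calc ‖y‖ = ‖u k + (y - u k)‖ := by rw [add_sub_cancel]
        _ ≤ ‖u k‖ + ‖y - u k‖ := norm_add_le _ _
    linarith

/-! ## `L^q` bounds along `L¹` limits and the `L¹ → L⁴` upgrade -/

/-- **Uniform `L^q` bounds pass to `L¹` limits** (Fatou along an a.e.-convergent subsequence):
if `∫_B |f_j − g| → 0` and `∫_B |f_j|^q ≤ M` for all `j` then `∫_B |g|^q ≤ M` (any real `q`). [folklore] -/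
theorem lintegral_rpow_le_of_tendsto_lintegral {μ : Measure E3} {f : ℕ → E3 → E3} {g : E3 → E3}
    (hf : ∀ j, AEStronglyMeasurable (f j) μ) (hg : AEStronglyMeasurable g μ) (q : ℝ)
    (hlim : Tendsto (fun j => ∫⁻ y, ‖f j y - g y‖ₑ ∂μ) atTop (𝓝 0)) {M : ℝ≥0∞}
    (hM : ∀ j, ∫⁻ y, ‖f j y‖ₑ ^ q ∂μ ≤ M) : ∫⁻ y, ‖g y‖ₑ ^ q ∂μ ≤ M := by
  have hL1 : Tendsto (fun j => eLpNorm (f j - g) 1 μ) atTop (𝓝 0) := by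
    refine (tendsto_congr fun j => ?_).2 hlim
    rw [eLpNorm_one_eq_lintegral_enorm]
    rfl
  obtain ⟨ns, -, hae⟩ :=
    (tendstoInMeasure_of_tendsto_eLpNorm one_ne_zero hf hg hL1).exists_seq_tendsto_ae
  have hlimf : ∀ᵐ y ∂μ, Tendsto (fun i => ‖f (ns i) y‖ₑ ^ q) atTop (𝓝 (‖g y‖ₑ ^ q)) := by
    filter_upwards [hae] with y hy
    exact ((ENNReal.continuous_rpow_const.tendsto _).comp hy.enorm)
  calc ∫⁻ y, ‖g y‖ₑ ^ q ∂μ = ∫⁻ y, liminf (fun i => ‖f (ns i) y‖ₑ ^ q) atTop ∂μ :=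
        lintegral_congr_ae (hlimf.mono fun y hy => hy.liminf_eq.symm)
    _ ≤ liminf (fun i => ∫⁻ y, ‖f (ns i) y‖ₑ ^ q ∂μ) atTop :=
        lintegral_liminf_le' fun i => ((hf (ns i)).enorm.pow_const q)
    _ ≤ M := liminf_le_of_frequently_le' (Frequently.of_forall fun i => hM (ns i))

/-- **`L¹(B) → L⁴(B)` by interpolation with a uniform `L^q(B)` bound, `q > 4`**: if
`∫_B |f_j − g| → 0`, `∫_B |f_j|^q ≤ M`, `∫_B |g|^q ≤ M`, `M < ∞`, then `∫_B |f_j − g|⁴ → 0`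
(`∫h⁴ ≤ (∫h)^{(q−4)/(q−1)}(∫h^q)^{3/(q−1)}` and `∫|f_j − g|^q ≤ 2^{q−1}·2M`). This is the step
«strongly in L^{q₀}_loc» of (3.28) with `q₀ = 4 < q < 9/2`. [cite: Wu2026, (3.26)–(3.28) p.11] -/
theorem tendsto_lintegral_rpow_four_of_one {μ : Measure E3} {f : ℕ → E3 → E3} {g : E3 → E3}
    (hf : ∀ j, AEStronglyMeasurable (f j) μ) (hg : AEStronglyMeasurable g μ) {q : ℝ} (hq : 4 < q)
    (hlim : Tendsto (fun j => ∫⁻ y, ‖f j y - g y‖ₑ ∂μ) atTop (𝓝 0)) {M : ℝ≥0∞} (hMt : M ≠ ∞)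
    (hM : ∀ j, ∫⁻ y, ‖f j y‖ₑ ^ q ∂μ ≤ M) (hgM : ∫⁻ y, ‖g y‖ₑ ^ q ∂μ ≤ M) :
    Tendsto (fun j => ∫⁻ y, ‖f j y - g y‖ₑ ^ (4 : ℝ) ∂μ) atTop (𝓝 0) := by
  have hq1 : 1 ≤ q := by linarith
  have hq0 : 0 ≤ q := by linarith
  -- uniform `L^q` bound on the differences
  have hdq : ∀ j, ∫⁻ y, ‖f j y - g y‖ₑ ^ q ∂μ ≤ 2 ^ (q - 1) * (M + M) := by
    intro j
    calc ∫⁻ y, ‖f j y - g y‖ₑ ^ q ∂μ ≤ ∫⁻ y, 2 ^ (q - 1) * (‖f j y‖ₑ ^ q + ‖g y‖ₑ ^ q) ∂μ :=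
          lintegral_mono fun y => (ENNReal.rpow_le_rpow enorm_sub_le hq0).trans
            (ENNReal.rpow_add_le_mul_rpow_add_rpow _ _ hq1)
      _ = 2 ^ (q - 1) * ((∫⁻ y, ‖f j y‖ₑ ^ q ∂μ) + ∫⁻ y, ‖g y‖ₑ ^ q ∂μ) := by
          rw [lintegral_const_mul' _ _ (ENNReal.rpow_ne_top_of_nonneg (by linarith)
            ENNReal.ofNat_ne_top), lintegral_add_left' ((hf j).enorm.pow_const q)]
      _ ≤ 2 ^ (q - 1) * (M + M) := by gcongr; exact hM j
  -- interpolation `1 < 4 < q`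
  have hmeas : ∀ j, AEMeasurable (fun y => ‖f j y - g y‖ₑ) μ := fun j => ((hf j).sub hg).enorm
  have hint : ∀ j, ∫⁻ y, ‖f j y - g y‖ₑ ^ (4 : ℝ) ∂μ ≤
      (∫⁻ y, ‖f j y - g y‖ₑ ^ (1 : ℝ) ∂μ) ^ ((q - 4) / (q - 1)) *
        (∫⁻ y, ‖f j y - g y‖ₑ ^ q ∂μ) ^ ((4 - 1) / (q - 1)) := fun j =>
    lintegral_rpow_interpolate (hmeas j) one_pos (by linarith) (by norm_num) hq.le
  simp only [ENNReal.rpow_one] at hint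
  have hB : (2 ^ (q - 1) * (M + M)) ^ ((4 - 1) / (q - 1)) ≠ ∞ :=
    ENNReal.rpow_ne_top_of_nonneg (div_nonneg (by norm_num) (by linarith))
      (ENNReal.mul_ne_top (ENNReal.rpow_ne_top_of_nonneg (by linarith) ENNReal.ofNat_ne_top)
        (ENNReal.add_ne_top.2 ⟨hMt, hMt⟩))
  have hmain := tendsto_rpow_mul_const_zero hlim (div_pos (by linarith) (by linarith) :
    (0 : ℝ) < (q - 4) / (q - 1)) hB
  refine tendsto_zero_of_le hmain fun j => (hint j).trans ?_
  gcongr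
  exact hdq j

/-- Finite subadditivity of the set integral over a finite union of sets. [folklore] -/
theorem lintegral_biUnion_finset_le (t : Finset ℕ) (B : ℕ → Set E3) (f : E3 → ℝ≥0∞) :
    ∫⁻ y in ⋃ k ∈ t, B k, f y ≤ ∑ k ∈ t, ∫⁻ y in B k, f y := by
  classical
  induction t using Finset.induction_on with
  | empty => simp
  | insert a s ha ih =>
      rw [Finset.set_biUnion_insert, Finset.sum_insert ha]
      exact (lintegral_union_le _ _ _).trans (add_le_add le_rfl ih)

end Summit.NavierStokesRegularity.NavierStokesRegularity.Theorems.Wu2026Salvage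

end

-- WHAT THIS IS NOT: not a claim about NS regularity or blow-up; not a claim about any author beyond the typed locator.
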